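import Mathlib
import Literature.Analysis.Complex.PlanePotentialEstimates
import Literature.Analysis.Complex.CauchyTransformSupport
import HarnessLib

/-!
# A uniform modulus of continuity for Cauchy transforms of bounded densities

Topic `Literature/Analysis/Complex`. For a bounded measurable density `a : ℂ → F` (`‖a‖ ≤ N`,
`a = 0` off the disc `‖z‖ < R`, `F` a complex Banach space) the Cauchy transform
`T a = cauchyTransformAlong 1 a`, `(T a)(z) = ∫ (π t)⁻¹ • a(z - t) dA(t) = -∫ (π (ζ - z))⁻¹ • a ζ dA(ζ)`,
is Hölder continuous of exponent `1/2` with a constant depending only on `N`, `R` and `‖z‖`: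

* `norm_cauchyTransform_sub_le_sqrt` —
  `‖(T a)(z) - (T a)(z')‖ ≤ 2 N (3 + 2 (R + ‖z‖)) √‖z - z'‖` for `‖z - z'‖ ≤ 1/4`.

(Classically `T` maps `L^∞` densities of compact support into every Hölder class `C^{0,α}`,
`α < 1`, indeed into the log-Lipschitz class — I. N. Vekua, *Generalized analytic functions*
(1962), Ch. I, §6, Thm. 1.19; the exponent `1/2` with an elementary constant is all that is needed
for EQUICONTINUITY of the potentials `s = T a` of the `δ`-regularisation device of the similarity
principle, uniformly in the regularisation parameter, which is how
`Literature/Analysis/Complex/SimilarityFactorisationC1.lean` extracts a CONTINUOUS factor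
`c = e^{s} H`.) Proof: with `d = ‖z - z'‖` and `δ = √d ≥ 2d`, the kernel difference
`(ζ - z')⁻¹ - (ζ - z)⁻¹` is bounded by `|ζ - z'|⁻¹ + |ζ - z|⁻¹` on the disc `|ζ - z| < δ` and by
`d / (|ζ - z'| |ζ - z|) ≤ 2d |ζ - z|⁻² ≤ 2δ |ζ - z|⁻¹` off it (`norm_inv_sub_inv_sub_le`); both are
integrated with the tree's `∫_{B(c,ρ)} |ζ - p|⁻¹ dA ≤ 2π (ρ + |p - c|)`
(`Literature.Analysis.Complex.lintegral_inv_norm_sub_ball_le`).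

Everything is proved; no named facts.

## References

* I. N. Vekua, *Generalized analytic functions* (1962), Ch. I, §6 (properties of the operator `T`).
* L. Hörmander, *An Introduction to Complex Analysis in Several Variables* (1973), Thm. 1.2.2.
  [HormanderSCV1973]
-/

noncomputable section

open MeasureTheory Metric Set Filter Topology
open scoped Real ENNReal

namespace Literature.Analysis.Complex

variable {F : Type*} [NormedAddCommGroup F] [NormedSpace ℂ F]

/-! ### The kernel difference -/

/-- **Pointwise bound for the difference of two Cauchy kernels.** With `d = ‖z - z'‖`, `δ² = d`,
`0 < δ`, `2d ≤ δ`: for every `ζ`,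
`‖(ζ - z')⁻¹ - (ζ - z)⁻¹‖ ≤ 𝟙_{B(z,δ)}(ζ) (‖ζ - z'‖⁻¹ + ‖ζ - z‖⁻¹) + 2δ ‖ζ - z‖⁻¹`
(near `z`: the triangle inequality; far from `z`: `|ζ - z'| ≥ |ζ - z| / 2` and
`d / (|ζ - z'| |ζ - z|) ≤ 2d / |ζ - z|² ≤ 2δ / |ζ - z|`). [folklore] -/
theorem norm_inv_sub_inv_sub_le {ζ z z' : ℂ} {d δ : ℝ} (hd : ‖z - z'‖ = d) (hδ : δ ^ 2 = d)
    (hδpos : 0 < δ) (h2d : 2 * d ≤ δ) :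
    ‖(ζ - z')⁻¹ - (ζ - z)⁻¹‖ ≤
      (ball z δ).indicator (fun ζ => ‖ζ - z'‖⁻¹ + ‖ζ - z‖⁻¹) ζ + 2 * δ * ‖ζ - z‖⁻¹ := by
  by_cases hnear : ζ ∈ ball z δ
  · rw [indicator_of_mem hnear]
    have h1 : ‖(ζ - z')⁻¹ - (ζ - z)⁻¹‖ ≤ ‖ζ - z'‖⁻¹ + ‖ζ - z‖⁻¹ := by
      refine (norm_sub_le _ _).trans ?_
      rw [norm_inv, norm_inv]
    have h2 : 0 ≤ 2 * δ * ‖ζ - z‖⁻¹ := by positivity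
    linarith
  · rw [indicator_of_notMem hnear, zero_add]
    have hfar : δ ≤ ‖ζ - z‖ := by rwa [mem_ball, dist_eq_norm, not_lt] at hnear
    have hd0 : 0 ≤ d := by rw [← hd]; exact norm_nonneg _
    have hA : 0 < ‖ζ - z‖ := hδpos.trans_le hfar
    have hzne : ζ - z ≠ 0 := norm_pos_iff.1 hA
    have hz'far : ‖ζ - z‖ / 2 ≤ ‖ζ - z'‖ := by
      have h := norm_sub_norm_le (ζ - z) (z' - z)
      have e : (ζ - z) - (z' - z) = ζ - z' := by ring
      rw [e, norm_sub_rev z' z, hd] at h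
      linarith
    have hB : 0 < ‖ζ - z'‖ := by linarith
    have hz'ne : ζ - z' ≠ 0 := norm_pos_iff.1 hB
    have hid : (ζ - z')⁻¹ - (ζ - z)⁻¹ = (z' - z) / ((ζ - z') * (ζ - z)) := by
      field_simp
      ring
    rw [hid, norm_div, norm_mul, norm_sub_rev z' z, hd, div_le_iff₀ (by positivity)]
    calc d = δ * δ := by rw [← hδ]; ring
      _ ≤ δ * (2 * ‖ζ - z'‖) := by gcongr; linarith
      _ = 2 * δ * ‖ζ - z‖⁻¹ * (‖ζ - z'‖ * ‖ζ - z‖) := by field_simp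

/-! ### Integrability of the Cauchy integrand -/

/-- The integrand `ζ ↦ (π (ζ - w))⁻¹ • a ζ` of the Cauchy transform of a bounded measurable density
vanishing off a disc is integrable. [folklore] -/
theorem integrable_cauchyKernel_smul {a : ℂ → F} (ha : AEStronglyMeasurable a volume) {N R : ℝ}
    (haN : ∀ z, ‖a z‖ ≤ N) (ha0 : ∀ z, a z ≠ 0 → ‖z‖ < R) (w : ℂ) :
    Integrable fun ζ : ℂ => ((↑π * (ζ - w))⁻¹ : ℂ) • a ζ := by
  have h := (integrable_inv_sub_smul ha haN ha0 w).smul (-(↑π)⁻¹ : ℂ)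
  refine h.congr (Eventually.of_forall fun ζ => ?_)
  show (-(↑π)⁻¹ : ℂ) • ((w - ζ)⁻¹ • a ζ) = ((↑π * (ζ - w))⁻¹ : ℂ) • a ζ
  rw [smul_smul, mul_inv, ← neg_sub ζ w, inv_neg]
  ring_nf

/-! ### The modulus of continuity -/

/-- **Hölder-`1/2` modulus of the Cauchy transform of a bounded density.** If `a : ℂ → F` is
measurable with `‖a‖ ≤ N` and `a = 0` off `‖z‖ < R`, then for `‖z - z'‖ ≤ 1/4`
`‖(T a)(z) - (T a)(z')‖ ≤ 2 N (3 + 2 (R + ‖z‖)) √‖z - z'‖`.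
[cite: HormanderSCV1973, Thm. 1.2.2] -/
theorem norm_cauchyTransform_sub_le_sqrt [CompleteSpace F] {a : ℂ → F}
    (ha : AEStronglyMeasurable a volume) {N R : ℝ} (hN : 0 ≤ N) (hR : 0 ≤ R)
    (haN : ∀ z, ‖a z‖ ≤ N) (ha0 : ∀ z, a z ≠ 0 → ‖z‖ < R) {z z' : ℂ} (hzz' : ‖z - z'‖ ≤ 1 / 4) :
    ‖cauchyTransformAlong 1 a z - cauchyTransformAlong 1 a z'‖ ≤
      2 * N * (3 + 2 * (R + ‖z‖)) * Real.sqrt ‖z - z'‖ := by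
  by_cases hzeq : z = z'
  · subst hzeq
    simp
  -- `d = ‖z - z'‖ > 0` and `δ = √d`, with `2d ≤ δ` and `d ≤ δ`
  set d : ℝ := ‖z - z'‖ with hd_def
  have hd0 : 0 < d := norm_pos_iff.2 (sub_ne_zero.2 hzeq)
  set δ : ℝ := Real.sqrt d with hδ_def
  have hδ : δ ^ 2 = d := Real.sq_sqrt hd0.le
  have hδpos : 0 < δ := Real.sqrt_pos.2 hd0
  have h2d : 2 * d ≤ δ := by
    rw [hδ_def, Real.le_sqrt (by positivity) hd0.le]
    nlinarith
  have hdδ : d ≤ δ := by linarith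
  -- the difference as one integral
  have hint := integrable_cauchyKernel_smul ha haN ha0
  have hdiff : cauchyTransformAlong 1 a z - cauchyTransformAlong 1 a z' =
      ∫ ζ, (((↑π * (ζ - z'))⁻¹ : ℂ) - ((↑π * (ζ - z))⁻¹ : ℂ)) • a ζ := by
    rw [SimilarityVector.cauchyTransform_eq_neg_integral,
      SimilarityVector.cauchyTransform_eq_neg_integral, neg_sub_neg,
      ← integral_sub (hint z') (hint z)]
    congr 1
    funext ζ
    rw [sub_smul]
  rw [hdiff]
  -- the majorant
  set c₁ : ℝ := N * π⁻¹ with hc₁_def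
  have hc₁ : 0 ≤ c₁ := by positivity
  set m : ℂ → ℝ≥0∞ := fun ζ =>
    (ball z δ).indicator (fun ζ => ENNReal.ofReal (c₁ * (‖ζ - z'‖⁻¹ + ‖ζ - z‖⁻¹))) ζ +
      (ball (0 : ℂ) R).indicator (fun ζ => ENNReal.ofReal (c₁ * (2 * δ) * ‖ζ - z‖⁻¹)) ζ
    with hm_def
  have hpt : ∀ ζ, ENNReal.ofReal ‖(((↑π * (ζ - z'))⁻¹ : ℂ) - ((↑π * (ζ - z))⁻¹ : ℂ)) • a ζ‖ ≤
      m ζ := by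
    intro ζ
    by_cases haz : a ζ = 0
    · simp [haz]
    have hζR : ζ ∈ ball (0 : ℂ) R := mem_ball_zero_iff.2 (ha0 ζ haz)
    have hker : ((↑π * (ζ - z'))⁻¹ : ℂ) - ((↑π * (ζ - z))⁻¹ : ℂ) =
        (↑π)⁻¹ * ((ζ - z')⁻¹ - (ζ - z)⁻¹) := by
      rw [mul_inv, mul_inv, mul_sub]
    rw [norm_smul, hker, norm_mul, norm_inv, Complex.norm_real, Real.norm_of_nonneg Real.pi_pos.le]
    have hk := norm_inv_sub_inv_sub_le (ζ := ζ) hd_def.symm hδ hδpos h2d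
    have haζ := haN ζ
    have hkn : 0 ≤ ‖(ζ - z')⁻¹ - (ζ - z)⁻¹‖ := norm_nonneg _
    by_cases hnear : ζ ∈ ball z δ
    · rw [indicator_of_mem hnear] at hk
      simp only [hm_def, indicator_of_mem hnear, indicator_of_mem hζR]
      rw [← ENNReal.ofReal_add (by positivity) (by positivity)]
      refine ENNReal.ofReal_le_ofReal ?_
      calc π⁻¹ * ‖(ζ - z')⁻¹ - (ζ - z)⁻¹‖ * ‖a ζ‖
          ≤ π⁻¹ * (‖ζ - z'‖⁻¹ + ‖ζ - z‖⁻¹ + 2 * δ * ‖ζ - z‖⁻¹) * N := by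
            gcongr
        _ = c₁ * (‖ζ - z'‖⁻¹ + ‖ζ - z‖⁻¹) + c₁ * (2 * δ) * ‖ζ - z‖⁻¹ := by
            rw [hc₁_def]; ring
    · rw [indicator_of_notMem hnear, zero_add] at hk
      simp only [hm_def, indicator_of_notMem hnear, indicator_of_mem hζR, zero_add]
      refine ENNReal.ofReal_le_ofReal ?_
      calc π⁻¹ * ‖(ζ - z')⁻¹ - (ζ - z)⁻¹‖ * ‖a ζ‖ ≤ π⁻¹ * (2 * δ * ‖ζ - z‖⁻¹) * N := by
            gcongr
        _ = c₁ * (2 * δ) * ‖ζ - z‖⁻¹ := by rw [hc₁_def]; ring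
  -- the two pieces of the majorant
  have hmeas₁ : Measurable fun ζ : ℂ =>
      (ball z δ).indicator (fun ζ => ENNReal.ofReal (c₁ * (‖ζ - z'‖⁻¹ + ‖ζ - z‖⁻¹))) ζ := by
    refine Measurable.indicator ?_ measurableSet_ball
    exact (measurable_const.mul ((measurable_id.sub_const z').norm.inv.add
      (measurable_id.sub_const z).norm.inv)).ennreal_ofReal
  have I₁ : ∫⁻ ζ in ball z δ, ENNReal.ofReal (c₁ * (‖ζ - z'‖⁻¹ + ‖ζ - z‖⁻¹)) ≤
      ENNReal.ofReal (c₁ * (2 * π * (δ + d) + 2 * π * δ)) := by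
    have hsplit : ∀ ζ, ENNReal.ofReal (c₁ * (‖ζ - z'‖⁻¹ + ‖ζ - z‖⁻¹)) =
        ENNReal.ofReal c₁ * (ENNReal.ofReal ‖z' - ζ‖⁻¹ + ENNReal.ofReal ‖ζ - z‖⁻¹) := by
      intro ζ
      rw [ENNReal.ofReal_mul hc₁, ENNReal.ofReal_add (by positivity) (by positivity),
        norm_sub_rev ζ z']
    have hmeas₂ : Measurable fun ζ : ℂ => ENNReal.ofReal ‖z' - ζ‖⁻¹ :=
      (measurable_const.sub measurable_id).norm.inv.ennreal_ofReal
    simp_rw [hsplit]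
    rw [lintegral_const_mul' _ _ ENNReal.ofReal_ne_top, lintegral_add_left hmeas₂]
    calc ENNReal.ofReal c₁ * ((∫⁻ ζ in ball z δ, ENNReal.ofReal ‖z' - ζ‖⁻¹) +
          ∫⁻ ζ in ball z δ, ENNReal.ofReal ‖ζ - z‖⁻¹)
        ≤ ENNReal.ofReal c₁ * (ENNReal.ofReal (2 * π * (δ + ‖z' - z‖)) +
            ENNReal.ofReal (2 * π * δ)) := by
          gcongr
          · exact lintegral_inv_norm_sub_ball_le z z' hδpos.le
          · exact (lintegral_inv_norm_sub_ball_self z hδpos.le).le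
      _ = ENNReal.ofReal (c₁ * (2 * π * (δ + d) + 2 * π * δ)) := by
          rw [norm_sub_rev z' z, ← hd_def, ← ENNReal.ofReal_add (by positivity) (by positivity),
            ← ENNReal.ofReal_mul hc₁]
  have I₂ : ∫⁻ ζ in ball (0 : ℂ) R, ENNReal.ofReal (c₁ * (2 * δ) * ‖ζ - z‖⁻¹) ≤
      ENNReal.ofReal (c₁ * (2 * δ) * (2 * π * (R + ‖z‖))) := by
    have hsplit : ∀ ζ, ENNReal.ofReal (c₁ * (2 * δ) * ‖ζ - z‖⁻¹) =
        ENNReal.ofReal (c₁ * (2 * δ)) * ENNReal.ofReal ‖ζ - z‖⁻¹ := fun ζ => by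
      rw [ENNReal.ofReal_mul (by positivity)]
    simp_rw [hsplit]
    rw [lintegral_const_mul' _ _ ENNReal.ofReal_ne_top]
    calc ENNReal.ofReal (c₁ * (2 * δ)) * ∫⁻ ζ in ball (0 : ℂ) R, ENNReal.ofReal ‖ζ - z‖⁻¹
        ≤ ENNReal.ofReal (c₁ * (2 * δ)) * ENNReal.ofReal (2 * π * (R + ‖z - 0‖)) := by
          gcongr
          exact lintegral_inv_norm_sub_ball_le' 0 z hR
      _ = ENNReal.ofReal (c₁ * (2 * δ) * (2 * π * (R + ‖z‖))) := by
          rw [sub_zero, ← ENNReal.ofReal_mul (by positivity)]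
  -- assemble
  refine (norm_integral_le_lintegral_norm _).trans ?_
  refine ENNReal.toReal_le_of_le_ofReal (by positivity) ?_
  calc ∫⁻ ζ, ENNReal.ofReal ‖(((↑π * (ζ - z'))⁻¹ : ℂ) - ((↑π * (ζ - z))⁻¹ : ℂ)) • a ζ‖
      ≤ ∫⁻ ζ, m ζ := lintegral_mono hpt
    _ = (∫⁻ ζ in ball z δ, ENNReal.ofReal (c₁ * (‖ζ - z'‖⁻¹ + ‖ζ - z‖⁻¹))) +
          ∫⁻ ζ in ball (0 : ℂ) R, ENNReal.ofReal (c₁ * (2 * δ) * ‖ζ - z‖⁻¹) := by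
        rw [hm_def, lintegral_add_left hmeas₁, lintegral_indicator measurableSet_ball,
          lintegral_indicator measurableSet_ball]
    _ ≤ ENNReal.ofReal (c₁ * (2 * π * (δ + d) + 2 * π * δ)) +
          ENNReal.ofReal (c₁ * (2 * δ) * (2 * π * (R + ‖z‖))) := add_le_add I₁ I₂
    _ = ENNReal.ofReal (c₁ * (2 * π * (δ + d) + 2 * π * δ) +
          c₁ * (2 * δ) * (2 * π * (R + ‖z‖))) :=
        (ENNReal.ofReal_add (by positivity) (by positivity)).symm
    _ ≤ ENNReal.ofReal (2 * N * (3 + 2 * (R + ‖z‖)) * δ) := by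
        refine ENNReal.ofReal_le_ofReal ?_
        have hπ : π⁻¹ * π = 1 := inv_mul_cancel₀ Real.pi_pos.ne'
        calc c₁ * (2 * π * (δ + d) + 2 * π * δ) + c₁ * (2 * δ) * (2 * π * (R + ‖z‖))
            = (π⁻¹ * π) * (2 * N * (2 * δ + d) + 4 * N * δ * (R + ‖z‖)) := by
              rw [hc₁_def]; ring
          _ = 2 * N * (2 * δ + d) + 4 * N * δ * (R + ‖z‖) := by rw [hπ, one_mul]
          _ ≤ 2 * N * (2 * δ + δ) + 4 * N * δ * (R + ‖z‖) := by gcongr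
          _ = 2 * N * (3 + 2 * (R + ‖z‖)) * δ := by ring

end Literature.Analysis.Complex

end
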